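import Mathlib
import Literature.NumberTheory.LFunctions.Zhang2022.Section16I3plusShift
import Literature.NumberTheory.LFunctions.Zhang2022.Section2ZfacTwoSided
import Literature.NumberTheory.LFunctions.Zhang2022.Section2CriticalLineReality
import Literature.NumberTheory.LFunctions.Zhang2022.Section16Eq162Edge
import Literature.NumberTheory.LFunctions.Zhang2022.ToolkitDivisorMajorants
import HarnessLib

/-!
# Zhang (2022) §16 p. 89, step `Z22:§16.u004` — tools: the integrand `𝒦₂(s,ψ)ω(s)` of `I₃⁻(ψ)` to
# the LEFT of the critical line (holomorphy and size on `½−A ≤ σ ≤ ½−α`)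

Topic `Literature/NumberTheory/LFunctions/Zhang2022` (Landau–Siegel audit tree; verdict-neutral).
Y. Zhang, *Discrete mean estimates and the Landau–Siegel zero*, arXiv:2211.02515v1 (2022)
[Zhang2022LandauSiegel] — **an unrefereed manuscript under adjudication; nothing in this file asserts or
denies its Theorems 1–2.** ZHANG-L discharge lane (WP16), leaf `Typed.Section16A.Step16_u010 c′`, node
`Z22:§16.u004` (§16 p. 89, tex L4417):

> "Note that the length of the sum `B(s,ψ)N(s+β₃,ψ)` is `≤ PT⁻¹`. For `ψ ∈ Ψ₁`, moving the segment
> `𝔍(−α)` to `𝔍(−𝓛⁹)` we obtain, by simple estimation, `I₃⁻(ψ) ≪ ε`."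

The "simple estimation" made explicit (this file; the move itself is `Section16I3minusSmall`). For
`𝒦₂(s,ψ) = Z(s,χψ)⁻¹·(L(s+β₁,ψ)/L(s,ψ))·B(s,ψ)N(s+β₃,ψ)K(1−s−β₂,ψ̄)` (u001) and `s = σ + it` with
`w := ½ − σ ∈ [α, A]`, `|t − 2πt₀| ≤ 𝓛₁`:

* `LFunction_ne_zero_left` — `L(s,ψ) ≠ 0` for `σ < ½` in the window: by the functional equation
  `L(s,ψ) = Z(s,ψ)L(1−s,ψ̄)` (tree `GammaFactor.LFunction_eq_Zfac_mul`) and `L(1−s,ψ̄) = conj L(1−s̄,ψ)`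
  (tree `GammaFactor.LFunction_inv_conj_eq`), the zeros reflect to `Re = 1−σ > ½`, excluded "by
  Proposition 2.2" (`Step8u016.LFunction_ne_zero_of_onLine`, zeros of `L(s,ψ)L(s,ψχ)` in `Ω` on the line);
* `differentiableAt_calK2_omega`, `differentiableOn_calK2_omega_left` — holomorphy of `𝒦₂ω` at any point
  with `Im s > 0`, `L(s,ψ) ≠ 0`, hence on `[½−A, ½−α] × [2πt₀−𝓛₁, 2πt₀+𝓛₁]`;
* `norm_calK2_omega_le_left` — the SIZE: with `S_B = Σ_{n<P}|b₁(n)|` and `Λ ≥ |L(1−s,ψ̄)|⁻¹`,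
  `|𝒦₂(s)ω(s)| ≤ e³(8/(Dt₀))^{w}·S_B·(2P₄+1)²·p(A+3+10t₀)Z·Λ·(√π/𝓛₂)e^{(w²−(t−2πt₀)²)/(4𝓛₂²)}` — from the
  two-sided Stirling sizes `|Z(s,χψ)⁻¹| ≤ e(Dpt/2π)^{−w}`, `|Z(s+β₁,ψ)| ≤ e(p(t+b₁)/2π)^{w}`,
  `|Z(s,ψ)⁻¹| ≤ e(pt/2π)^{−w}` (tree `GammaFactor.norm_Zfac_and_inv_le`), the support `b₁(n) = 0` for `n ≥ P`
  (so `|B(s)N(s+β₃)| ≤ S_B·P^{w}`), `|K| ≤ (2P₄+1)²`, `|L(1−s−β₁,ψ̄)| ≤ p‖·‖Z`; the four `w`-powers combine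
  to `(8P/(Dpt₀))^{w} ≤ (8/(Dt₀))^{w}` — the decay that makes `𝔍(−𝓛⁹)` negligible ("length `≤ PT⁻¹`");
* `norm_inv_LFunction_reflect_le` (`Λ = 2E`, `E` the `DirichletDisc` constant, for `w ≥ α`) and
  `norm_inv_LFunction_reflect_le_two` (`Λ = 2` for `w ≥ 3/2`); `sum_norm_b1coef_le` (`S_B ≤ 16K_BP⁴`).

Theorems only; no definitions, no named facts; axioms standard. WHAT THIS IS NOT: the estimate
`I₃⁻(ψ) ≪ ε` itself (next file), nor any claim about Theorems 1–2 of the source.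

## References

* Y. Zhang, arXiv:2211.02515v1 (2022), §16 p. 89 (u004), §2 (2.2)–(2.5), §15 (15.2).
  [cite: Zhang2022LandauSiegel, §16 p.89 (u004)]
* H. L. Montgomery, R. C. Vaughan, *Multiplicative Number Theory I* (2007), Lemma 12.6; §10.1.
  [cite: MontgomeryVaughan2007, Lemma 12.6]
-/

noncomputable section

open Complex Real Set Metric MeasureTheory ComplexConjugate
open Literature.NumberTheory.LFunctions.Zhang2022.Skeleton
open Literature.NumberTheory.LFunctions.Zhang2022.Typed.Section16A

namespace Literature.NumberTheory.LFunctions.Zhang2022.Step16u010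

open Literature.NumberTheory.LFunctions.Zhang2022

/-! ## Zero-freeness of `L(s,ψ)` left of the critical line and holomorphy of `𝒦₂ω` -/

section Holomorphy

variable (c' : ℝ) {D : ℕ} [NeZero D] {χ : DirichletCharacter ℂ D} (x : Chr D)

omit [NeZero D] in
/-- `‖L(w,ψ̄)‖ = ‖L(w̄,ψ)‖` (`L(w,ψ̄) = conj L(w̄,ψ)`, tree `GammaFactor.LFunction_inv_conj_eq`).
[cite: Zhang2022LandauSiegel, §13 p.74] -/
theorem norm_LFunction_inv_eq (w : ℂ) :
    ‖x.ψ⁻¹.LFunction w‖ = ‖x.ψ.LFunction (conj w)‖ := by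
  rw [GammaFactor.LFunction_inv_conj_eq x.ψ_ne_one x.p_ne_one, Complex.norm_conj]

/-- **`L(s,ψ) ≠ 0` to the LEFT of the critical line inside the window** (`σ < ½`, `Im s > 0`,
`|t − 2πt₀| < 𝓛₁ + 2`), for `ψ ∈ Ψ₁` with the zeros of `L(s,ψ)L(s,ψχ)` in `Ω` on the line: by
`L(s,ψ) = Z(s,ψ)L(1−s,ψ̄)`, `Z ≠ 0` on `Im s > 0`, and `L(1−s,ψ̄) = conj L(1−s̄,ψ) ≠ 0` as `Re(1−s̄) > ½`.
[cite: Zhang2022LandauSiegel, §16 p.89 (u004); §2 (2.2)] -/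
theorem LFunction_ne_zero_left (h22 : ∀ s ∈ prodZeroSetOmega χ x, s.re = 1 / 2) {s : ℂ}
    (him : 0 < s.im) (hre : s.re < 1 / 2) (himw : |s.im - 2 * π * t0 D| < ell1 D + 2) :
    x.ψ.LFunction s ≠ 0 := by
  rw [GammaFactor.LFunction_eq_Zfac_mul x.prim x.p_ne_one (ne_of_gt him)]
  refine mul_ne_zero (GammaFactor.Zfac_ne_zero x.prim him) ?_
  rw [← norm_pos_iff, norm_LFunction_inv_eq, norm_pos_iff]
  refine Step8u016.LFunction_ne_zero_of_onLine h22 ?_ ?_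
  · simp; linarith
  · simpa using himw

/-- **`𝒦₂(s,ψ)ω(s)` is complex differentiable at every `s` with `Im s > 0` and `L(s,ψ) ≠ 0`** (`D ≥ 3`,
`χ` primitive: `Z(s,χψ)⁻¹` holomorphic on `Im s > 0`; `L(·,ψ)`, `B`, `N`, `K`, `ω` entire).
[cite: Zhang2022LandauSiegel, §16 p.88 (u001)] -/
theorem differentiableAt_calK2_omega (hD : 3 ≤ D) (hp : χ.IsPrimitive) {s : ℂ} (him : 0 < s.im)
    (hL : x.ψ.LFunction s ≠ 0) :
    DifferentiableAt ℂ (fun s => calK2 c' χ x s * omegaW D s) s := by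
  have hprim := psiChiPrimitive_holds D χ x hD hp
  have hLd := DirichletCharacter.differentiable_LFunction x.ψ_ne_one
  have hZ : DifferentiableAt ℂ (fun s => (Zpc χ x s)⁻¹) s := by
    unfold Zpc
    exact (GammaFactor.differentiableAt_Zfac (psiChi χ x) him).inv
      (GammaFactor.Zfac_ne_zero hprim him)
  have hL1 : DifferentiableAt ℂ (fun s => x.ψ.LFunction (s + beta1 c' D)) s :=
    (hLd.comp (differentiable_id.add_const _)).differentiableAt
  have hL0 : DifferentiableAt ℂ (fun s => x.ψ.LFunction s) s := hLd.differentiableAt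
  have hB : DifferentiableAt ℂ (Bpoly χ x) s :=
    (Typed.Section17.differentiable_Bpoly χ x).differentiableAt
  have hN : DifferentiableAt ℂ (fun s => Nchar D (psiFn x) (s + beta3 c' D)) s :=
    ((Typed.Section17.differentiable_Nchar (psiFn x)).comp
      (differentiable_id.add_const _)).differentiableAt
  have hK : DifferentiableAt ℂ (fun s => Kchar D (psiBarFn x) (1 - s - beta2 c' D)) s :=
    ((differentiable_Kchar (psiBarFn x)).comp
      (((differentiable_const (1 : ℂ)).sub differentiable_id).sub_const _)).differentiableAt
  have hω : DifferentiableAt ℂ (omegaW D) s := (Section7aStatements.differentiable_omegaW D) s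
  have hfun : (fun s => calK2 c' χ x s * omegaW D s) = fun s =>
      (Zpc χ x s)⁻¹ * (x.ψ.LFunction (s + beta1 c' D) / x.ψ.LFunction s) * Bpoly χ x s *
        Nchar D (psiFn x) (s + beta3 c' D) * Kchar D (psiBarFn x) (1 - s - beta2 c' D) *
        omegaW D s := by
    funext s; rfl
  rw [hfun]
  exact ((((hZ.mul (hL1.div hL0 hL)).mul hB).mul hN).mul hK).mul hω

/-- **`𝒦₂(s,ψ)ω(s)` is holomorphic on the closed LEFT rectangle `[½−A, ½−α] × [2πt₀−𝓛₁, 2πt₀+𝓛₁]`**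
for `ψ ∈ Ψ₁` (zeros of `L(s,ψ)L(s,ψχ)` in `Ω` on the line; `0 < α ≤ A`, `𝓛₁ < 2πt₀`, `D ≥ 3`, `χ` primitive).
[cite: Zhang2022LandauSiegel, §16 p.89 (u004)] -/
theorem differentiableOn_calK2_omega_left (hD : 3 ≤ D) (hp : χ.IsPrimitive)
    (h22 : ∀ s ∈ prodZeroSetOmega χ x, s.re = 1 / 2) {A : ℝ} (hα0 : 0 < alpha D)
    (hαA : alpha D ≤ A) (hwin : ell1 D < 2 * π * t0 D) :
    DifferentiableOn ℂ (fun s => calK2 c' χ x s * omegaW D s)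
      (Set.uIcc (1 / 2 + -A) (1 / 2 + -alpha D) ×ℂ
        Set.uIcc (2 * π * t0 D - ell1 D) (2 * π * t0 D + ell1 D)) := by
  intro s hs
  have hre : 1 / 2 + -A ≤ s.re ∧ s.re ≤ 1 / 2 + -alpha D := by
    have h := hs.1
    rw [Set.uIcc_of_le (by linarith)] at h
    exact h
  have hℓ1 : 0 ≤ ell1 D := pow_nonneg (Real.log_natCast_nonneg D) _
  have him : 2 * π * t0 D - ell1 D ≤ s.im ∧ s.im ≤ 2 * π * t0 D + ell1 D := by
    have h := hs.2
    rw [Set.uIcc_of_le (by linarith)] at h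
    exact h
  have him0 : 0 < s.im := by linarith
  have himw : |s.im - 2 * π * t0 D| < ell1 D + 2 := by
    rw [abs_lt]; constructor <;> linarith
  have hL : x.ψ.LFunction s ≠ 0 := LFunction_ne_zero_left x h22 him0 (by linarith) himw
  exact (differentiableAt_calK2_omega c' x hD hp him0 hL).differentiableWithinAt

end Holomorphy

/-! ## The reflected `L`-values `L(1−s,ψ̄)`, `L(1−s−β₁,ψ̄)` -/

section Reflected

variable (c' : ℝ) {D : ℕ} [NeZero D] {χ : DirichletCharacter ℂ D} (x : Chr D)

omit [NeZero D] in
/-- **`|L(1−s−β₁,ψ̄)| ≤ p·(A + 3 + 10t₀)·Z`** for `s = σ+it` with `½ − σ ∈ [0, A]`, `|t − 2πt₀| ≤ 𝓛₁ ≤ πt₀`,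
`|b₁| ≤ 1` (`L(1−s−β₁,ψ̄) = conj L(1−s̄+β₁,ψ)`, and the tree's `|L(v,ψ)| ≤ p‖v‖Z` on `Re v ≥ ¼`,
`DirichletZFR.norm_LFunction_le_of_re_ge`). [cite: MontgomeryVaughan2007, Lemma 10.15] -/
theorem norm_LFunction_inv_shift_le {A : ℝ} {s : ℂ} (hw0 : 0 ≤ 1 / 2 - s.re) (hwA : 1 / 2 - s.re ≤ A)
    (ht : |s.im - 2 * π * t0 D| ≤ ell1 D) (hℓ1 : ell1 D ≤ π * t0 D) (ht0 : 0 ≤ t0 D)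
    (hb1 : |b1 c' D| ≤ 1) :
    ‖x.ψ⁻¹.LFunction (1 - (s + beta1 c' D))‖ ≤
      (x.p : ℝ) * (A + 3 + 10 * t0 D) * DirichletDisc.Zc := by
  rw [norm_LFunction_inv_eq]
  set v : ℂ := conj (1 - (s + beta1 c' D)) with hv
  have hb : beta1 c' D = (b1 c' D : ℂ) * I := beta1_eq_b1_mul_I c' D
  have hvre : v.re = 1 - s.re := by
    rw [hv, Complex.conj_re, Complex.sub_re, Complex.add_re, hb]; simp
  have hvre' : 1 / 4 ≤ v.re := by rw [hvre]; linarith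
  have h := DirichletZFR.norm_LFunction_le_of_re_ge (χ := x.ψ) x.ψ_ne_one hvre'
  have hZc : DirichletDisc.Zc = ∑' n : ℕ, ((n + 1 : ℕ) : ℝ) ^ (-(5 / 4 : ℝ)) := rfl
  rw [← hZc] at h
  refine h.trans ?_
  have hZ0 : 0 ≤ DirichletDisc.Zc := le_trans zero_le_one DirichletDisc.one_le_Zc
  have hp0 : (0 : ℝ) ≤ x.p := Nat.cast_nonneg _
  refine mul_le_mul_of_nonneg_right (mul_le_mul_of_nonneg_left ?_ hp0) hZ0
  -- `‖v‖ = ‖1 − s − β₁‖ ≤ |Re| + |Im| ≤ (A + 1) + (3πt₀ + 1)`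
  have hnv : ‖v‖ = ‖1 - (s + beta1 c' D)‖ := by rw [hv, Complex.norm_conj]
  rw [hnv]
  have hre : (1 - (s + beta1 c' D)).re = 1 - s.re := by
    rw [Complex.sub_re, Complex.add_re, hb]; simp
  have him : (1 - (s + beta1 c' D)).im = -(s.im + b1 c' D) := by
    rw [Complex.sub_im, Complex.add_im, hb]; simp
  have h1 := Complex.norm_le_abs_re_add_abs_im (1 - (s + beta1 c' D))
  rw [hre, him, abs_neg] at h1
  have hA1 : |1 - s.re| ≤ A + 1 := by rw [abs_le]; constructor <;> linarith
  have ht' := abs_le.mp ht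
  have hb1' := abs_le.mp hb1
  have hπt : 3 * π * t0 D ≤ 10 * t0 D := by nlinarith [Real.pi_lt_d2]
  have hπ0 : 0 ≤ π * t0 D := by nlinarith [Real.pi_gt_three]
  have hti : |s.im + b1 c' D| ≤ 2 + 10 * t0 D := by
    rw [abs_le]; constructor <;> linarith
  linarith

omit [NeZero D] in
/-- **`|L(1−s,ψ̄)|⁻¹ ≤ 2`** when `½ − σ ≥ 3/2` (`Re(1−s̄) ≥ 2`, where `|L| ≥ (σ'−1)/σ' ≥ ½`; tree
`DirichletZFR.norm_LFunction_ge`). [cite: MontgomeryVaughan2007, Lemma 11.1] -/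
theorem norm_inv_LFunction_reflect_le_two {s : ℂ} (hw : 3 / 2 ≤ 1 / 2 - s.re) :
    ‖(x.ψ⁻¹.LFunction (1 - s))⁻¹‖ ≤ 2 := by
  rw [norm_inv, norm_LFunction_inv_eq]
  have hre : (conj (1 - s)).re = 1 - s.re := by simp
  have hre2 : 2 ≤ (conj (1 - s)).re := by rw [hre]; linarith
  have h := DirichletZFR.norm_LFunction_ge (χ := x.ψ) (s := conj (1 - s)) (by linarith)
  have hhalf : (1 : ℝ) / 2 ≤ ((conj (1 - s)).re - 1) / (conj (1 - s)).re := by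
    rw [div_le_div_iff₀ (by norm_num) (by linarith)]; linarith
  have hpos : 0 < ‖x.ψ.LFunction (conj (1 - s))‖ := lt_of_lt_of_le (by norm_num) (hhalf.trans h)
  rw [inv_le_comm₀ hpos (by norm_num)]
  linarith [hhalf.trans h]

/-- **`|L(1−s,ψ̄)|⁻¹ ≤ 2·exp(C(1+log(1/α))(log p + log(|t|+4)))`** for `ψ ∈ Ψ₁` (zeros on the line),
`s = σ + it` with `½ − σ ≥ α`, `|t − 2πt₀| ≤ 𝓛₁`, `0 < α ≤ 1`: for `Re(1−s̄) = 1−σ ≤ 2` this is the tree's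
lower bound off the zeros (`DirichletDisc.exp_neg_le_norm_LFunction`, all disc zeros on `σ = ½` at distance
`≥ α`), for `Re(1−s̄) > 2` the trivial `|L| ≥ ½`. [cite: MontgomeryVaughan2007, Lemma 12.6] -/
theorem norm_inv_LFunction_reflect_le {C : ℝ} (hC0 : 0 < C)
    (hC : ∀ (q : ℕ) [NeZero q] (θ : DirichletCharacter ℂ q), θ ≠ 1 → ∀ t σ d : ℝ,
      1 / 2 ≤ σ → σ ≤ 2 → 0 < d → d ≤ 1 →
        (∀ ρ ∈ DirichletDisc.discZeros θ t, ∀ y ∈ Icc σ 2, d ≤ ‖(y : ℂ) + t * I - ρ‖) →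
          Real.exp (-(C * (1 + Real.log (1 / d)) * (Real.log q + Real.log (|t| + 4)))) ≤
            ‖θ.LFunction ((σ : ℂ) + t * I)‖)
    (h22 : ∀ s ∈ prodZeroSetOmega χ x, s.re = 1 / 2) (hα0 : 0 < alpha D) (hα1 : alpha D ≤ 1)
    {s : ℂ} (hw : alpha D ≤ 1 / 2 - s.re) (ht : |s.im - 2 * π * t0 D| ≤ ell1 D) :
    ‖(x.ψ⁻¹.LFunction (1 - s))⁻¹‖ ≤
      2 * Real.exp (C * (1 + Real.log (1 / alpha D)) * (Real.log x.p + Real.log (|s.im| + 4))) := by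
  set E : ℝ := Real.exp (C * (1 + Real.log (1 / alpha D)) * (Real.log x.p + Real.log (|s.im| + 4)))
    with hE
  have hp1 : (1 : ℝ) ≤ x.p := by exact_mod_cast x.prime.one_lt.le
  have hE1 : 1 ≤ E := by
    rw [hE]; apply Real.one_le_exp
    have h1 : 0 ≤ 1 + Real.log (1 / alpha D) := by
      have : 1 ≤ 1 / alpha D := by rw [le_div_iff₀ hα0]; linarith
      linarith [Real.log_nonneg this]
    have h2 : 0 ≤ Real.log x.p + Real.log (|s.im| + 4) :=
      add_nonneg (Real.log_nonneg hp1) (Real.log_nonneg (by linarith [abs_nonneg s.im]))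
    exact mul_nonneg (mul_nonneg hC0.le h1) h2
  rw [norm_inv, norm_LFunction_inv_eq]
  have hu : conj (1 - s) = ((1 - s.re : ℝ) : ℂ) + s.im * I := by
    apply Complex.ext <;> simp
  rcases le_or_gt (1 - s.re) 2 with hσ2 | hσ2
  · -- the Montgomery–Vaughan lower bound off the zeros
    have hdist := DirichletDisc.dist_segment_of_re_le (χ := x.ψ) (t := s.im) (σ := 1 - s.re)
      (d := alpha D) (fun ρ hρ => by rw [Step8u016.discZeros_re_eq_half h22 ht ρ hρ]; linarith)
    have hLlow := hC x.p x.ψ x.ψ_ne_one s.im (1 - s.re) (alpha D) (by linarith) hσ2 hα0 hα1 hdist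
    rw [← hu] at hLlow
    have hpos : 0 < ‖x.ψ.LFunction (conj (1 - s))‖ := lt_of_lt_of_le (Real.exp_pos _) hLlow
    have hE0 : 0 < E := by linarith
    calc ‖x.ψ.LFunction (conj (1 - s))‖⁻¹ ≤ E := by
          rw [inv_le_comm₀ hpos hE0, hE, ← Real.exp_neg]; exact hLlow
      _ ≤ 2 * E := by linarith
  · have h2 := norm_inv_LFunction_reflect_le_two x (s := s) (by linarith)
    rw [norm_inv, norm_LFunction_inv_eq] at h2
    linarith

end Reflected

/-! ## The size of `𝒦₂(s,ψ)ω(s)` on the left region -/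

section LeftBound

variable (c' : ℝ) {D : ℕ} [NeZero D] {χ : DirichletCharacter ℂ D} (x : Chr D)

/-- **`B(s,ψ)N(s+β₃,ψ)` as the finite sum `Σ_{n<⌈P⌉} b₁(n)ψ(n)n^{−s}`** for `𝓛 ≥ 10` (u007 with the support
`b₁(n) = 0` for `n ≥ P`, tree `Typed.Section16ALeaves.b1coef_eq_zero_of_le`/`suppBound_le_bigP`).
[cite: Zhang2022LandauSiegel, §16 p.89 (u007)] -/
theorem Bpoly_mul_Nchar_eq_sum (hℓ : 10 ≤ ell D) (s : ℂ) :
    Bpoly χ x s * Nchar D (psiFn x) (s + beta3 c' D) =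
      ∑ n ∈ Finset.Ico 1 ⌈bigP D⌉₊, b1coef c' χ n * psiFn x n * (n : ℂ) ^ (-s) := by
  rw [Bpoly_mul_Nchar_eq_LSeries c' χ x s, LSeries]
  rw [tsum_eq_sum (s := Finset.Ico 1 ⌈bigP D⌉₊)]
  · refine Finset.sum_congr rfl fun n hn => ?_
    have hn1 : 1 ≤ n := (Finset.mem_Ico.mp hn).1
    rw [LSeries.term_of_ne_zero (by omega), div_eq_mul_inv, Complex.cpow_neg]
  · intro n hn
    rcases eq_or_ne n 0 with rfl | h0
    · simp [LSeries.term]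
    · have hge : ⌈bigP D⌉₊ ≤ n := by
        by_contra hlt
        exact hn (Finset.mem_Ico.mpr ⟨Nat.one_le_iff_ne_zero.mpr h0, not_le.mp hlt⟩)
      have hreal : 2 * bigT D ^ 2 * (bigP D ^ (1 / 2 : ℝ) * max (Skeleton.P2 D) (P3 D)) ≤ (n : ℝ) :=
        (Typed.Section16ALeaves.suppBound_le_bigP hℓ).trans
          (le_trans (Nat.le_ceil _) (by exact_mod_cast hge))
      rw [LSeries.term_of_ne_zero h0, Typed.Section16ALeaves.b1coef_eq_zero_of_le c' χ hreal,
        zero_mul, zero_div]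

/-- **`|B(s,ψ)N(s+β₃,ψ)| ≤ S_B·P^{½−σ}`** for `σ ≤ ½`, `𝓛 ≥ 10`, with `S_B = Σ_{n<⌈P⌉}|b₁(n)|`
(each `|n^{−s}| = n^{−σ} ≤ n^{½−σ} ≤ P^{½−σ}` for `1 ≤ n < P`). [cite: Zhang2022LandauSiegel, §16 p.89 (u004)] -/
theorem norm_Bpoly_mul_Nchar_le_left (hℓ : 10 ≤ ell D) {s : ℂ} (hw0 : 0 ≤ 1 / 2 - s.re) :
    ‖Bpoly χ x s * Nchar D (psiFn x) (s + beta3 c' D)‖ ≤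
      (∑ n ∈ Finset.Ico 1 ⌈bigP D⌉₊, ‖b1coef c' χ n‖) * bigP D ^ (1 / 2 - s.re) := by
  rw [Bpoly_mul_Nchar_eq_sum c' x hℓ, Finset.sum_mul]
  have hP0 : 0 < bigP D := Real.exp_pos _
  refine (norm_sum_le _ _).trans (Finset.sum_le_sum fun n hn => ?_)
  obtain ⟨hn1, hn2⟩ := Finset.mem_Ico.mp hn
  have hnP : (n : ℝ) < bigP D := Nat.lt_ceil.mp hn2
  have hn1' : (1 : ℝ) ≤ n := by exact_mod_cast hn1
  rw [norm_mul, norm_mul, Complex.norm_natCast_cpow_of_pos hn1]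
  have hψ : ‖psiFn x n‖ ≤ 1 := x.ψ.norm_le_one _
  have hpow : (n : ℝ) ^ (-s).re ≤ bigP D ^ (1 / 2 - s.re) := by
    calc (n : ℝ) ^ (-s).re ≤ (n : ℝ) ^ (1 / 2 - s.re) :=
          Real.rpow_le_rpow_of_exponent_le hn1' (by rw [Complex.neg_re]; linarith)
      _ ≤ bigP D ^ (1 / 2 - s.re) := Real.rpow_le_rpow (by linarith) hnP.le hw0
  calc ‖b1coef c' χ n‖ * ‖psiFn x n‖ * (n : ℝ) ^ (-s).re
      ≤ ‖b1coef c' χ n‖ * 1 * bigP D ^ (1 / 2 - s.re) := by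
        refine mul_le_mul (mul_le_mul_of_nonneg_left hψ (norm_nonneg _)) hpow
          (Real.rpow_nonneg (by linarith) _) (by positivity)
    _ = ‖b1coef c' χ n‖ * bigP D ^ (1 / 2 - s.re) := by ring

omit [NeZero D] in
/-- **`S_B = Σ_{n<⌈P⌉}|b₁(n)| ≤ 16K_B·P⁴`**, `K_B = (1+|ι₂|)(|ι₃|+|ι₄|)` (`|b₁| ≤ K_Bτ₃`, `Σ_{n≤Y}τ₃(n) ≤
Y(1+log Y)³ ≤ Y⁴`), for `𝓛 ≥ 2`. [cite: Zhang2022LandauSiegel, §15 (15.2); §16 p.89 (u007)] -/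
theorem sum_norm_b1coef_le (hℓ : 2 ≤ ell D) :
    (∑ n ∈ Finset.Ico 1 ⌈bigP D⌉₊, ‖b1coef c' χ n‖) ≤
      16 * ((1 + ‖iota2‖) * (‖iota3‖ + ‖iota4‖)) * bigP D ^ 4 := by
  set KB : ℝ := (1 + ‖iota2‖) * (‖iota3‖ + ‖iota4‖) with hKB
  have hKB0 : 0 ≤ KB := by rw [hKB]; positivity
  set Y : ℕ := ⌈bigP D⌉₊ with hY
  have hP0 : 0 < bigP D := Real.exp_pos _
  have hP1 : 1 ≤ bigP D := Real.one_le_exp (pow_nonneg (Real.log_natCast_nonneg D) 9)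
  have hY1 : (1 : ℝ) ≤ Y := by
    rw [hY]; exact_mod_cast Nat.one_le_iff_ne_zero.mpr (Nat.ceil_pos.mpr hP0).ne'
  have hYP : (Y : ℝ) ≤ 2 * bigP D := by
    rw [hY]; have := Nat.ceil_lt_add_one hP0.le; linarith
  -- `Σ_{n<Y} |b₁(n)| ≤ K_B Σ_{n≤Y} τ₃(n) ≤ K_B · Y · (1 + log Y)³`
  have h1 : (∑ n ∈ Finset.Ico 1 Y, ‖b1coef c' χ n‖) ≤
      KB * ∑ n ∈ Finset.Icc 1 Y, MeanSquareMajorant.tau 3 n := by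
    rw [Finset.mul_sum]
    have hsub : Finset.Ico 1 Y ⊆ Finset.Icc 1 Y := fun n hn => by
      rw [Finset.mem_Ico] at hn; rw [Finset.mem_Icc]; omega
    calc (∑ n ∈ Finset.Ico 1 Y, ‖b1coef c' χ n‖)
        ≤ ∑ n ∈ Finset.Ico 1 Y, KB * MeanSquareMajorant.tau 3 n :=
          Finset.sum_le_sum fun n _ => by
            have := norm_b1coef_le c' χ hℓ n
            rw [one_mul] at this; exact this
      _ ≤ ∑ n ∈ Finset.Icc 1 Y, KB * MeanSquareMajorant.tau 3 n :=
          Finset.sum_le_sum_of_subset_of_nonneg hsub fun n _ _ =>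
            mul_nonneg hKB0 (MeanSquareMajorant.tau_nonneg _ _)
  have h2 : (∑ n ∈ Finset.Icc 1 Y, MeanSquareMajorant.tau 3 n) ≤ Y * (1 + Real.log Y) ^ 3 := by
    have hs := MeanSquareMajorant.sum_tau_div_Icc_le_log_pow 3 Y
    calc (∑ n ∈ Finset.Icc 1 Y, MeanSquareMajorant.tau 3 n)
        = ∑ n ∈ Finset.Icc 1 Y, (n : ℝ) * (MeanSquareMajorant.tau 3 n / n) := by
          refine Finset.sum_congr rfl fun n hn => ?_
          have hn0 : (n : ℝ) ≠ 0 := by exact_mod_cast (show n ≠ 0 by have := (Finset.mem_Icc.mp hn).1; omega)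
          field_simp
      _ ≤ ∑ n ∈ Finset.Icc 1 Y, (Y : ℝ) * (MeanSquareMajorant.tau 3 n / n) :=
          Finset.sum_le_sum fun n hn => by
            have hnY : (n : ℝ) ≤ Y := by exact_mod_cast (Finset.mem_Icc.mp hn).2
            exact mul_le_mul_of_nonneg_right hnY
              (div_nonneg (MeanSquareMajorant.tau_nonneg _ _) (Nat.cast_nonneg _))
      _ = (Y : ℝ) * ∑ n ∈ Finset.Icc 1 Y, MeanSquareMajorant.tau 3 n / n := by rw [Finset.mul_sum]
      _ ≤ Y * (1 + Real.log Y) ^ 3 := mul_le_mul_of_nonneg_left hs (Nat.cast_nonneg _)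
  -- `1 + log Y ≤ Y`, `Y ≤ 2P`
  have hlogY : 1 + Real.log Y ≤ Y := by
    have := Real.add_one_le_exp (Real.log Y)
    rw [Real.exp_log (by linarith)] at this; linarith
  have hlog0 : 0 ≤ 1 + Real.log Y := by linarith [Real.log_nonneg hY1]
  calc (∑ n ∈ Finset.Ico 1 Y, ‖b1coef c' χ n‖) ≤ KB * (Y * (1 + Real.log Y) ^ 3) :=
        h1.trans (mul_le_mul_of_nonneg_left h2 hKB0)
    _ ≤ KB * (Y * (Y : ℝ) ^ 3) := by
        gcongr
    _ = KB * (Y : ℝ) ^ 4 := by ring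
    _ ≤ KB * (2 * bigP D) ^ 4 := by gcongr
    _ = 16 * KB * bigP D ^ 4 := by ring

/-- **The integrand of `I₃⁻` on the left region** (`Z22:§16.u004`, "simple estimation"). Let `D ≥ 3`,
`χ` primitive, `𝓛 ≥ 10`, `|b₁| ≤ 1`, `1 ≤ A` with `A(2A+11) + 2(A+3) ≤ πt₀ − 1` (Stirling range),
`𝓛₁ ≤ πt₀`, and `s = σ + it` with `w := ½ − σ ∈ [0, A]`, `|t − 2πt₀| ≤ 𝓛₁`; let `Λ ≥ |L(1−s,ψ̄)|⁻¹`. Then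
`|𝒦₂(s,ψ)ω(s)| ≤ e³·(8/(Dt₀))^{w}·S_B·(2P₄+1)²·(p(A+3+10t₀)Z)·Λ·(√π/𝓛₂)e^{(w² − (t−2πt₀)²)/(4𝓛₂²)}`,
`S_B = Σ_{n<⌈P⌉}|b₁(n)|`. The factor `(8/(Dt₀))^{w}` collects `|Z(s,χψ)⁻¹||Z(s+β₁,ψ)||Z(s,ψ)⁻¹|·P^{w}
≤ e³(2/(Dpt₀))^{w}(2pt₀)^{w}(2/(pt₀))^{w}P^{w} ≤ e³(8/(Dt₀))^{w}` (`P ≤ p`).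
[cite: Zhang2022LandauSiegel, §16 p.89 (u004)] -/
theorem norm_calK2_omega_le_left (hD : 3 ≤ D) (hp : χ.IsPrimitive) (hℓ : 10 ≤ ell D)
    (hb1 : |b1 c' D| ≤ 1) {A : ℝ} (hA : 1 ≤ A)
    (hStir : A * (2 * A + 11) + 2 * (A + 3) ≤ π * t0 D - 1) (hℓ1 : ell1 D ≤ π * t0 D)
    {s : ℂ} (hw0 : 0 ≤ 1 / 2 - s.re) (hwA : 1 / 2 - s.re ≤ A) (ht : |s.im - 2 * π * t0 D| ≤ ell1 D)
    {Λ : ℝ} (hΛ : ‖(x.ψ⁻¹.LFunction (1 - s))⁻¹‖ ≤ Λ) :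
    ‖calK2 c' χ x s * omegaW D s‖ ≤
      Real.exp 3 * (8 / ((D : ℝ) * t0 D)) ^ (1 / 2 - s.re) *
        (∑ n ∈ Finset.Ico 1 ⌈bigP D⌉₊, ‖b1coef c' χ n‖) * (2 * P4 D + 1) ^ 2 *
        ((x.p : ℝ) * (A + 3 + 10 * t0 D) * DirichletDisc.Zc) * Λ *
        (Real.sqrt π / ell2 D * Real.exp (((1 / 2 - s.re) ^ 2 - (s.im - 2 * π * t0 D) ^ 2) /
          (4 * ell2 D ^ 2))) := by
  -- parameters
  have hℓ' : 1 ≤ ell D := by linarith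
  have hℓ0 : 0 < ell D := by linarith
  have ht0 : 1 ≤ t0 D := by rw [t0]; exact one_le_pow₀ hℓ'
  have ht00 : 0 < t0 D := by linarith
  have hπ3 := Real.pi_gt_three
  have hπ4 := Real.pi_lt_four
  have hD0 : (0 : ℝ) < D := by exact_mod_cast (show 0 < D by omega)
  have hD3 : (3 : ℝ) ≤ D := by exact_mod_cast hD
  have hp0 : (0 : ℝ) < x.p := by exact_mod_cast x.prime.pos
  have hpP : bigP D ≤ (x.p : ℝ) := by
    have h := (Finset.mem_filter.mp x.mem).1
    rw [Finset.mem_Ioo] at h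
    exact ((Nat.floor_lt (Real.exp_pos _).le).mp h.1).le
  have hP0 : 0 < bigP D := Real.exp_pos _
  set σ := s.re with hσ
  set t := s.im with htdef
  set w : ℝ := 1 / 2 - σ with hw
  have ht' := abs_le.mp ht
  have htlo : π * t0 D ≤ t := by linarith
  have hthi : t ≤ 3 * π * t0 D := by linarith
  have htpos : 0 < t := by
    have : (3 : ℝ) * 1 ≤ π * t0 D := mul_le_mul hπ3.le ht0 zero_le_one (by linarith)
    linarith
  have hb1' := abs_le.mp hb1
  obtain ⟨e1, -, -⟩ := Section8aStatements.beta_eq_b_mul_I c' D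
  -- the three `Z`-factors (two-sided Stirling sizes, `A' = A + 1`)
  have hA1 : 1 ≤ A + 1 := by linarith
  have hσabs : |s.re - 1 / 2| ≤ A + 1 := by rw [abs_le]; constructor <;> linarith
  have hprim := psiChiPrimitive_holds D χ x hD hp
  have hAA : 0 ≤ A * (2 * A + 11) := by positivity
  have htA : 2 * (A + 1 + 2) ≤ s.im := by linarith
  have htA' : 2 * (A + 1 + 2) ≤ t + b1 c' D := by linarith
  have hwδ : w * (2 * (A + 1) + 9) ≤ A * (2 * A + 11) := by
    calc w * (2 * (A + 1) + 9) = w * (2 * A + 11) := by ring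
      _ ≤ A * (2 * A + 11) := mul_le_mul_of_nonneg_right hwA (by linarith)
  have habsw : |s.re - 1 / 2| = w := by rw [abs_sub_comm]; exact abs_of_nonneg hw0
  have habsσ : |σ - 1 / 2| = w := by rw [abs_sub_comm, ← hw]; exact abs_of_nonneg hw0
  have hZ1 := (GammaFactor.norm_Zfac_and_inv_le hprim hA1 (s := s) hσabs htA
    (by rw [habsw]; linarith)).2
  -- `s + β₁`
  have hs1re : (s + beta1 c' D).re = σ := by rw [Complex.add_re, e1]; simp [hσ]
  have hs1im : (s + beta1 c' D).im = t + b1 c' D := by rw [Complex.add_im, e1]; simp [htdef]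
  have hZ2 := (GammaFactor.norm_Zfac_and_inv_le x.prim hA1 (s := s + beta1 c' D)
    (by rw [hs1re]; exact hσabs) (by rw [hs1im]; exact htA')
    (by rw [hs1re, hs1im, habsσ]; linarith)).1
  have hZ3 := (GammaFactor.norm_Zfac_and_inv_le x.prim hA1 (s := s) hσabs htA
    (by rw [habsw]; linarith)).2
  rw [hs1re, hs1im] at hZ2
  -- simplify the bases: exponent `σ − ½ = −w ≤ 0` resp. `½ − σ = w ≥ 0`
  have hk1 : ((D * x.p : ℕ) : ℝ) = (D : ℝ) * x.p := by push_cast; ring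
  have hexp : s.re - 1 / 2 = -w := by rw [hw, hσ]; ring
  have hDp : 0 < (D : ℝ) * x.p := mul_pos hD0 hp0
  have hb1pos : 0 < (D : ℝ) * x.p * t0 D / 2 := by
    have := mul_pos hDp ht00; linarith
  have hb3pos : 0 < (x.p : ℝ) * t0 D / 2 := by
    have := mul_pos hp0 ht00; linarith
  have hb2nn : 0 ≤ 2 * (x.p : ℝ) * t0 D := by
    have := mul_pos hp0 ht00; linarith
  have h2π : 0 < 2 * π := by linarith
  have hbase1 : (D : ℝ) * x.p * t0 D / 2 ≤ (D : ℝ) * x.p * t / (2 * π) := by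
    rw [div_le_div_iff₀ (by norm_num) h2π]
    have h1 : (D : ℝ) * x.p * (π * t0 D) ≤ (D : ℝ) * x.p * t :=
      mul_le_mul_of_nonneg_left htlo hDp.le
    calc (D : ℝ) * x.p * t0 D * (2 * π) = 2 * ((D : ℝ) * x.p * (π * t0 D)) := by ring
      _ ≤ 2 * ((D : ℝ) * x.p * t) := by linarith
      _ = (D : ℝ) * x.p * t * 2 := by ring
  have hπt1 : 1 ≤ π * t0 D := by
    have : (3 : ℝ) * 1 ≤ π * t0 D := mul_le_mul hπ3.le ht0 zero_le_one (by linarith)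
    linarith
  have hbase2 : (x.p : ℝ) * (t + b1 c' D) / (2 * π) ≤ 2 * x.p * t0 D := by
    rw [div_le_iff₀ h2π]
    have h1 : t + b1 c' D ≤ 4 * π * t0 D := by linarith
    calc (x.p : ℝ) * (t + b1 c' D) ≤ (x.p : ℝ) * (4 * π * t0 D) := mul_le_mul_of_nonneg_left h1 hp0.le
      _ = 2 * x.p * t0 D * (2 * π) := by ring
  have hbase3 : (x.p : ℝ) * t0 D / 2 ≤ (x.p : ℝ) * t / (2 * π) := by
    rw [div_le_div_iff₀ (by norm_num) h2π]
    have h1 : (x.p : ℝ) * (π * t0 D) ≤ (x.p : ℝ) * t := mul_le_mul_of_nonneg_left htlo hp0.le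
    calc (x.p : ℝ) * t0 D * (2 * π) = 2 * ((x.p : ℝ) * (π * t0 D)) := by ring
      _ ≤ 2 * ((x.p : ℝ) * t) := by linarith
      _ = (x.p : ℝ) * t * 2 := by ring
  have hF1 : ‖(Zpc χ x s)⁻¹‖ ≤ Real.exp 1 * ((D : ℝ) * x.p * t0 D / 2) ^ (-w) := by
    refine hZ1.trans ?_
    rw [hk1, hexp]
    refine mul_le_mul_of_nonneg_left ?_ (Real.exp_pos 1).le
    exact Real.rpow_le_rpow_of_nonpos hb1pos hbase1 (by linarith)
  have hF2 : ‖GammaFactor.Zfac x.ψ (s + beta1 c' D)‖ ≤ Real.exp 1 * (2 * x.p * t0 D) ^ w := by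
    refine hZ2.trans (mul_le_mul_of_nonneg_left ?_ (Real.exp_pos 1).le)
    rw [show 1 / 2 - σ = w by rw [hw]]
    have hnn : 0 ≤ (x.p : ℝ) * (t + b1 c' D) / (2 * π) := by
      apply div_nonneg _ h2π.le
      have : 0 ≤ t + b1 c' D := by linarith
      exact mul_nonneg hp0.le this
    exact Real.rpow_le_rpow hnn hbase2 hw0
  have hF3 : ‖(GammaFactor.Zfac x.ψ s)⁻¹‖ ≤ Real.exp 1 * ((x.p : ℝ) * t0 D / 2) ^ (-w) := by
    refine hZ3.trans ?_
    rw [hexp]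
    refine mul_le_mul_of_nonneg_left ?_ (Real.exp_pos 1).le
    exact Real.rpow_le_rpow_of_nonpos hb3pos hbase3 (by linarith)
  -- the Dirichlet polynomials and the reflected `L`-values
  have hBN := norm_Bpoly_mul_Nchar_le_left c' (χ := χ) x hℓ (s := s) hw0
  set SB : ℝ := ∑ n ∈ Finset.Ico 1 ⌈bigP D⌉₊, ‖b1coef c' χ n‖ with hSB
  have hSB0 : 0 ≤ SB := Finset.sum_nonneg fun n _ => norm_nonneg _
  have hKp : ‖Kchar D (psiBarFn x) (1 - s - beta2 c' D)‖ ≤ (2 * P4 D + 1) ^ 2 :=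
    norm_Kchar_le hℓ0 (fun n => by rw [psiBarFn, Complex.norm_conj]; exact x.ψ.norm_le_one _)
      (by
        rw [Complex.sub_re, Complex.sub_re, Complex.one_re,
          show (beta2 c' D).re = 0 by simp [beta2]]
        linarith)
  have hU := norm_LFunction_inv_shift_le c' x (A := A) (s := s) hw0 hwA ht hℓ1 ht00.le hb1
  -- the weight
  have hℓ20 : 0 < ell2 D := pow_pos hℓ0 _
  have hω : ‖omegaW D s‖ = Real.sqrt π / ell2 D *
      Real.exp ((w ^ 2 - (t - 2 * π * t0 D) ^ 2) / (4 * ell2 D ^ 2)) := by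
    have hs' : s = ((-w : ℝ) : ℂ) + SmoothWeight.s0 (t0 D) + ((t - 2 * π * t0 D : ℝ) : ℂ) * I := by
      rw [SmoothWeight.s0_def]; apply Complex.ext <;> simp [hw, hσ, htdef]
    rw [omegaW, hs', SmoothWeight.norm_omega_segment_eq hℓ20, neg_sq]
  -- the functional equation twice
  have him0 : s.im ≠ 0 := ne_of_gt htpos
  have him1 : (s + beta1 c' D).im ≠ 0 := by rw [hs1im]; exact ne_of_gt (by linarith)
  have hfe0 := GammaFactor.LFunction_eq_Zfac_mul x.prim x.p_ne_one him0
  have hfe1 := GammaFactor.LFunction_eq_Zfac_mul x.prim x.p_ne_one him1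
  -- assembly of the norm
  have hfun : calK2 c' χ x s * omegaW D s = (Zpc χ x s)⁻¹ *
      ((GammaFactor.Zfac x.ψ (s + beta1 c' D) * x.ψ⁻¹.LFunction (1 - (s + beta1 c' D))) *
        ((GammaFactor.Zfac x.ψ s)⁻¹ * (x.ψ⁻¹.LFunction (1 - s))⁻¹)) *
      (Bpoly χ x s * Nchar D (psiFn x) (s + beta3 c' D)) *
      Kchar D (psiBarFn x) (1 - s - beta2 c' D) * omegaW D s := by
    rw [calK2, hfe1, hfe0, div_eq_mul_inv, mul_inv]; ring
  rw [hfun, norm_mul, norm_mul, norm_mul, norm_mul, norm_mul, norm_mul, norm_mul, hω]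
  -- nonnegativity bookkeeping
  have hZc0 : 0 ≤ DirichletDisc.Zc := le_trans zero_le_one DirichletDisc.one_le_Zc
  have hΛ0 : 0 ≤ Λ := (norm_nonneg _).trans hΛ
  have hU0 : 0 ≤ (x.p : ℝ) * (A + 3 + 10 * t0 D) * DirichletDisc.Zc := by positivity
  have hr1 : 0 ≤ Real.exp 1 * ((D : ℝ) * x.p * t0 D / 2) ^ (-w) :=
    mul_nonneg (Real.exp_pos 1).le (Real.rpow_nonneg hb1pos.le _)
  have hr2 : 0 ≤ Real.exp 1 * (2 * x.p * t0 D) ^ w :=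
    mul_nonneg (Real.exp_pos 1).le (Real.rpow_nonneg hb2nn _)
  have hr3 : 0 ≤ Real.exp 1 * ((x.p : ℝ) * t0 D / 2) ^ (-w) :=
    mul_nonneg (Real.exp_pos 1).le (Real.rpow_nonneg hb3pos.le _)
  have hPw : 0 ≤ bigP D ^ w := Real.rpow_nonneg hP0.le _
  have hK0 : 0 ≤ (2 * P4 D + 1) ^ 2 := sq_nonneg _
  -- the `L`-ratio block
  have n_ratio : 0 ≤ (Real.exp 1 * (2 * x.p * t0 D) ^ w) *
      ((x.p : ℝ) * (A + 3 + 10 * t0 D) * DirichletDisc.Zc) *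
      ((Real.exp 1 * ((x.p : ℝ) * t0 D / 2) ^ (-w)) * Λ) :=
    mul_nonneg (mul_nonneg hr2 hU0) (mul_nonneg hr3 hΛ0)
  have hratio : ‖GammaFactor.Zfac x.ψ (s + beta1 c' D)‖ * ‖x.ψ⁻¹.LFunction (1 - (s + beta1 c' D))‖ *
      (‖(GammaFactor.Zfac x.ψ s)⁻¹‖ * ‖(x.ψ⁻¹.LFunction (1 - s))⁻¹‖) ≤
      (Real.exp 1 * (2 * x.p * t0 D) ^ w) * ((x.p : ℝ) * (A + 3 + 10 * t0 D) * DirichletDisc.Zc) *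
        ((Real.exp 1 * ((x.p : ℝ) * t0 D / 2) ^ (-w)) * Λ) :=
    mul_le_mul (mul_le_mul hF2 hU (norm_nonneg _) hr2) (mul_le_mul hF3 hΛ (norm_nonneg _) hr3)
      (mul_nonneg (norm_nonneg _) (norm_nonneg _)) (mul_nonneg hr2 hU0)
  have n1 : 0 ≤ (Real.exp 1 * ((D : ℝ) * x.p * t0 D / 2) ^ (-w)) *
      ((Real.exp 1 * (2 * x.p * t0 D) ^ w) * ((x.p : ℝ) * (A + 3 + 10 * t0 D) * DirichletDisc.Zc) *
        ((Real.exp 1 * ((x.p : ℝ) * t0 D / 2) ^ (-w)) * Λ)) := mul_nonneg hr1 n_ratio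
  have hmain : ‖(Zpc χ x s)⁻¹‖ *
      (‖GammaFactor.Zfac x.ψ (s + beta1 c' D)‖ * ‖x.ψ⁻¹.LFunction (1 - (s + beta1 c' D))‖ *
        (‖(GammaFactor.Zfac x.ψ s)⁻¹‖ * ‖(x.ψ⁻¹.LFunction (1 - s))⁻¹‖)) *
      ‖Bpoly χ x s * Nchar D (psiFn x) (s + beta3 c' D)‖ *
      ‖Kchar D (psiBarFn x) (1 - s - beta2 c' D)‖ ≤
      (Real.exp 1 * ((D : ℝ) * x.p * t0 D / 2) ^ (-w)) *
      ((Real.exp 1 * (2 * x.p * t0 D) ^ w) * ((x.p : ℝ) * (A + 3 + 10 * t0 D) * DirichletDisc.Zc) *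
        ((Real.exp 1 * ((x.p : ℝ) * t0 D / 2) ^ (-w)) * Λ)) *
      (SB * bigP D ^ w) * (2 * P4 D + 1) ^ 2 := by
    have g1 := mul_le_mul hF1 hratio
      (mul_nonneg (mul_nonneg (norm_nonneg _) (norm_nonneg _))
        (mul_nonneg (norm_nonneg _) (norm_nonneg _))) hr1
    have g2 := mul_le_mul g1 hBN (norm_nonneg _) n1
    exact mul_le_mul g2 hKp (norm_nonneg _) (mul_nonneg n1 (mul_nonneg hSB0 hPw))
  have hω0 : 0 ≤ Real.sqrt π / ell2 D *
      Real.exp ((w ^ 2 - (t - 2 * π * t0 D) ^ 2) / (4 * ell2 D ^ 2)) :=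
    mul_nonneg (div_nonneg (Real.sqrt_nonneg _) hℓ20.le) (Real.exp_pos _).le
  refine (mul_le_mul_of_nonneg_right hmain hω0).trans ?_
  -- combine the four `w`-powers: `(Dpt₀/2)^{−w}(2pt₀)^{w}(pt₀/2)^{−w}P^{w} = (8P/(Dpt₀))^{w} ≤ (8/(Dt₀))^{w}`
  have hpow : ((D : ℝ) * x.p * t0 D / 2) ^ (-w) * (2 * x.p * t0 D) ^ w *
      ((x.p : ℝ) * t0 D / 2) ^ (-w) * bigP D ^ w ≤ (8 / ((D : ℝ) * t0 D)) ^ w := by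
    have q1 : ((D : ℝ) * x.p * t0 D / 2) ^ (-w) = (((D : ℝ) * x.p * t0 D / 2)⁻¹) ^ w := by
      rw [Real.inv_rpow hb1pos.le, Real.rpow_neg hb1pos.le]
    have q3 : ((x.p : ℝ) * t0 D / 2) ^ (-w) = (((x.p : ℝ) * t0 D / 2)⁻¹) ^ w := by
      rw [Real.inv_rpow hb3pos.le, Real.rpow_neg hb3pos.le]
    have i1 : 0 ≤ ((D : ℝ) * x.p * t0 D / 2)⁻¹ := inv_nonneg.mpr hb1pos.le
    have i3 : 0 ≤ ((x.p : ℝ) * t0 D / 2)⁻¹ := inv_nonneg.mpr hb3pos.le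
    rw [q1, q3, ← Real.mul_rpow i1 hb2nn, ← Real.mul_rpow (mul_nonneg i1 hb2nn) i3,
      ← Real.mul_rpow (mul_nonneg (mul_nonneg i1 hb2nn) i3) hP0.le]
    refine Real.rpow_le_rpow (mul_nonneg (mul_nonneg (mul_nonneg i1 hb2nn) i3) hP0.le) ?_ hw0
    have hDt : 0 < (D : ℝ) * t0 D := mul_pos hD0 ht00
    have e : ((D : ℝ) * x.p * t0 D / 2)⁻¹ * (2 * x.p * t0 D) * ((x.p : ℝ) * t0 D / 2)⁻¹ * bigP D =
        8 * bigP D / x.p / ((D : ℝ) * t0 D) := by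
      field_simp
      ring
    rw [e]
    refine div_le_div_of_nonneg_right ?_ hDt.le
    rw [div_le_iff₀ hp0]
    linarith [hpP]
  have hrest0 : 0 ≤ SB * (2 * P4 D + 1) ^ 2 *
      ((x.p : ℝ) * (A + 3 + 10 * t0 D) * DirichletDisc.Zc) * Λ :=
    mul_nonneg (mul_nonneg (mul_nonneg hSB0 hK0) hU0) hΛ0
  calc Real.exp 1 * ((D : ℝ) * x.p * t0 D / 2) ^ (-w) *
        (Real.exp 1 * (2 * x.p * t0 D) ^ w * ((x.p : ℝ) * (A + 3 + 10 * t0 D) * DirichletDisc.Zc) *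
          (Real.exp 1 * ((x.p : ℝ) * t0 D / 2) ^ (-w) * Λ)) *
        (SB * bigP D ^ w) * (2 * P4 D + 1) ^ 2 *
        (Real.sqrt π / ell2 D * Real.exp ((w ^ 2 - (t - 2 * π * t0 D) ^ 2) / (4 * ell2 D ^ 2)))
      = (Real.exp 1 * Real.exp 1 * Real.exp 1) *
        (((D : ℝ) * x.p * t0 D / 2) ^ (-w) * (2 * x.p * t0 D) ^ w *
          ((x.p : ℝ) * t0 D / 2) ^ (-w) * bigP D ^ w) *
        (SB * (2 * P4 D + 1) ^ 2 * ((x.p : ℝ) * (A + 3 + 10 * t0 D) * DirichletDisc.Zc) * Λ) *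
        (Real.sqrt π / ell2 D * Real.exp ((w ^ 2 - (t - 2 * π * t0 D) ^ 2) / (4 * ell2 D ^ 2))) := by
        ring
    _ ≤ Real.exp 3 * (8 / ((D : ℝ) * t0 D)) ^ w *
        (SB * (2 * P4 D + 1) ^ 2 * ((x.p : ℝ) * (A + 3 + 10 * t0 D) * DirichletDisc.Zc) * Λ) *
        (Real.sqrt π / ell2 D * Real.exp ((w ^ 2 - (t - 2 * π * t0 D) ^ 2) / (4 * ell2 D ^ 2))) := by
        have he3 : Real.exp 1 * Real.exp 1 * Real.exp 1 = Real.exp 3 := by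
          rw [← Real.exp_add, ← Real.exp_add]; norm_num
        rw [he3]
        exact mul_le_mul_of_nonneg_right (mul_le_mul_of_nonneg_right
          (mul_le_mul_of_nonneg_left hpow (Real.exp_pos 3).le) hrest0) hω0
    _ = Real.exp 3 * (8 / ((D : ℝ) * t0 D)) ^ (1 / 2 - s.re) * SB * (2 * P4 D + 1) ^ 2 *
        ((x.p : ℝ) * (A + 3 + 10 * t0 D) * DirichletDisc.Zc) * Λ *
        (Real.sqrt π / ell2 D * Real.exp (((1 / 2 - s.re) ^ 2 - (s.im - 2 * π * t0 D) ^ 2) /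
          (4 * ell2 D ^ 2))) := by
        rw [hw, hσ, htdef]; ring

end LeftBound

end Literature.NumberTheory.LFunctions.Zhang2022.Step16u010
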